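import Summits.CriticalPhenomena.CardyFormulaZ2.Theses.CardyBoundaryCoulombGas
import Summits.CriticalPhenomena.CardyFormulaZ2.Theorems.CardyBoundaryCoulombGasStripClusterRatesBetheKernelToolkit

/-!
# Injectivity of the Bethe map on good convex sets
(helper U of line `two-cluster-rate-is-stationary-gap`, crux `StripClusterRates`,
stmt-CriticalPhenomena-13878)

The ground-state Bethe equations of the open staggered Temperley–Lieb(1) chain at `γ = π/3` read
`Φ(w)_j = π(j+1)` with the **Bethe map**
`Φ(w)_j := N·F(w_j) − Σ_{l ≠ j} [G(w_j − w_l) + G(w_j + w_l)]`,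
`F(w) = arctan((2+√3) tanh w) + arctan(tanh w)`, `G(x) = arctan(tanh x/√3)`, with derivatives
`F'(w) = (1/2)/(cosh 2w − √3/2) + 1/cosh 2w` and `G'(x) = (√3/2)/(cosh 2x + 1/2)`
(`bu_hasDerivAt_F`, `bu_hasDerivAt_G`).

**Theorem (`bu_betheMap_injOn`, registered helper U).** Assume the kernel `G'` is positive
semidefinite (`0 ≤ Σ_{j,l} G'(p_j − p_l) y_j y_l`, landed separately as `bu_kernel_posSemidef`). Then
`Φ` is injective on every convex set `D ⊆ ℝ^M` on which the diagonal Yang–Yang coefficients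
`c_j(w) := N F'(w_j) − Σ_{l ≠ j}[G'(w_j − w_l) + G'(w_j + w_l)] − G'(0) + G'(2 w_j)` are positive —
hence Bethe roots with given quantum numbers are unique in such a set.

## Proof

For `w, w' ∈ D` with `Φ w = Φ w'` put `d = w' − w` and `ψ(t) = Σ_j d_j Φ(w + t d)_j`, so
`ψ 0 = ψ 1`. Term-by-term differentiation (`bu_hasDerivAt_pairing`) gives `ψ'(t) = dᵀ DΦ(w + t d) d`,
and completing the square on the diagonal (`bu_quadForm_decomp`)
`dᵀ DΦ(u) d = Σ_j c_j(u) d_j² + Q(u, d)`, `Q(u, d) = Σ_{j,l} [G'(u_j − u_l) − G'(u_j + u_l)] d_j d_l`.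
By the reflection trick (`bu_reflect_nonneg`: `2Q` is the kernel quadratic form at the `2M` points
`(u, −u)` with weights `(d, −d)`, `G'` even) `Q ≥ 0`. Rolle gives `ξ ∈ (0,1)` with `ψ'(ξ) = 0`; at
`u = w + ξ d ∈ D` (convexity) this forces `Σ_j c_j(u) d_j² ≤ 0` with `c_j(u) > 0`, so `d = 0`.
The abstract statement is `bu_injOn_of_kernel_posSemidef`; the registered signature instantiates it
with the closed-form derivatives.
-/

noncomputable section

namespace Summit.CriticalPhenomena.CardyFormulaZ2.Cruxes.StripClusterRates.TwoClusterRateIsStationaryGap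

open Filter Topology
open scoped BigOperators

/-! ### Closed-form derivatives of the two Bethe phases -/

/-- Derivative of the momentum phase: `F'(w) = (1/2)/(cosh 2w − √3/2) + 1/cosh 2w` for
`F(w) = arctan((2+√3) tanh w) + arctan(tanh w)` (chain rule through `tanh' = 1/cosh²`, then
`cosh 2w = 2cosh² w − 1`, `(2+√3)² = 7 + 4√3`). [folklore] -/
theorem bu_hasDerivAt_F (w : ℝ) :
    HasDerivAt (fun w : ℝ ↦ Real.arctan ((2 + Real.sqrt 3) * Real.tanh w) + Real.arctan (Real.tanh w))
      (1 / 2 / (Real.cosh (2 * w) - Real.sqrt 3 / 2) + 1 / Real.cosh (2 * w)) w := by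
  have hC : Real.cosh w ≠ 0 := (Real.cosh_pos w).ne'
  -- derivative of `tanh = sinh / cosh`
  have htanh : HasDerivAt Real.tanh ((Real.cosh w ^ 2)⁻¹) w := by
    have h := (Real.hasDerivAt_sinh w).div (Real.hasDerivAt_cosh w) hC
    rw [show (Real.sinh / Real.cosh : ℝ → ℝ) = Real.tanh from
      funext fun y => (Real.tanh_eq_sinh_div_cosh y).symm] at h
    refine h.congr_deriv ?_
    rw [show Real.cosh w * Real.cosh w - Real.sinh w * Real.sinh w = 1 by
      linear_combination Real.cosh_sq_sub_sinh_sq w, one_div]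
  have h := ((htanh.const_mul (2 + Real.sqrt 3)).arctan).add htanh.arctan
  refine h.congr_deriv ?_
  -- the algebra `raw chain-rule value = closed form`
  have hr : Real.sqrt 3 ^ 2 = 3 := Real.sq_sqrt (by norm_num)
  have hr0 : 0 ≤ Real.sqrt 3 := Real.sqrt_nonneg 3
  have hr2 : Real.sqrt 3 < 2 := by nlinarith
  have hs : Real.sinh w ^ 2 = Real.cosh w ^ 2 - 1 := Real.sinh_sq w
  have h2 : Real.cosh (2 * w) = 2 * Real.cosh w ^ 2 - 1 := by rw [Real.cosh_two_mul]; linarith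
  have hC1 : 1 ≤ Real.cosh w := Real.one_le_cosh w
  have hd1 : Real.cosh (2 * w) - Real.sqrt 3 / 2 ≠ 0 := by
    have : 0 < Real.cosh (2 * w) - Real.sqrt 3 / 2 := by nlinarith
    exact this.ne'
  have hd2 : Real.cosh (2 * w) ≠ 0 := (Real.cosh_pos _).ne'
  rw [h2] at hd1 hd2 ⊢
  have hA : Real.cosh w ^ 2 + (2 + Real.sqrt 3) ^ 2 * Real.sinh w ^ 2 ≠ 0 := by
    have : 0 < Real.cosh w ^ 2 + (2 + Real.sqrt 3) ^ 2 * Real.sinh w ^ 2 := by positivity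
    exact this.ne'
  have hB : Real.cosh w ^ 2 + Real.sinh w ^ 2 ≠ 0 := by
    have : 0 < Real.cosh w ^ 2 + Real.sinh w ^ 2 := by positivity
    exact this.ne'
  have e1 : 1 / (1 + ((2 + Real.sqrt 3) * Real.tanh w) ^ 2) * ((2 + Real.sqrt 3) * (Real.cosh w ^ 2)⁻¹) =
      (2 + Real.sqrt 3) / (Real.cosh w ^ 2 + (2 + Real.sqrt 3) ^ 2 * Real.sinh w ^ 2) := by
    rw [Real.tanh_eq_sinh_div_cosh]
    field_simp
  have e2 : 1 / (1 + Real.tanh w ^ 2) * (Real.cosh w ^ 2)⁻¹ =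
      1 / (Real.cosh w ^ 2 + Real.sinh w ^ 2) := by
    rw [Real.tanh_eq_sinh_div_cosh]
    field_simp
  rw [e1, e2, hs]
  rw [hs] at hA hB
  rw [div_add_div _ _ hA hB, div_add_div _ _ hd1 hd2,
    div_eq_div_iff (mul_ne_zero hA hB) (mul_ne_zero hd1 hd2)]
  linear_combination (-(Real.cosh w) ^ 2 / 2 + 2 * Real.cosh w ^ 4 - 2 * Real.cosh w ^ 6) * hr

/-- Derivative of the scattering phase: `G'(x) = (√3/2)/(cosh 2x + 1/2)` for
`G(x) = arctan(tanh x/√3)`. [folklore] -/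
theorem bu_hasDerivAt_G (x : ℝ) :
    HasDerivAt (fun x : ℝ ↦ Real.arctan (Real.tanh x / Real.sqrt 3))
      (Real.sqrt 3 / 2 / (Real.cosh (2 * x) + 1 / 2)) x := by
  have hC : Real.cosh x ≠ 0 := (Real.cosh_pos x).ne'
  have htanh : HasDerivAt Real.tanh ((Real.cosh x ^ 2)⁻¹) x := by
    have h := (Real.hasDerivAt_sinh x).div (Real.hasDerivAt_cosh x) hC
    rw [show (Real.sinh / Real.cosh : ℝ → ℝ) = Real.tanh from
      funext fun y => (Real.tanh_eq_sinh_div_cosh y).symm] at h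
    refine h.congr_deriv ?_
    rw [show Real.cosh x * Real.cosh x - Real.sinh x * Real.sinh x = 1 by
      linear_combination Real.cosh_sq_sub_sinh_sq x, one_div]
  have h := (htanh.div_const (Real.sqrt 3)).arctan
  refine h.congr_deriv ?_
  have hr : Real.sqrt 3 ^ 2 = 3 := Real.sq_sqrt (by norm_num)
  have hr0 : 0 < Real.sqrt 3 := Real.sqrt_pos.2 (by norm_num)
  have hs : Real.sinh x ^ 2 = Real.cosh x ^ 2 - 1 := Real.sinh_sq x
  have h2 : Real.cosh (2 * x) = 2 * Real.cosh x ^ 2 - 1 := by rw [Real.cosh_two_mul]; linarith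
  have hd : Real.cosh (2 * x) + 1 / 2 ≠ 0 := by
    have : 0 < Real.cosh (2 * x) + 1 / 2 := by positivity
    exact this.ne'
  rw [h2] at hd ⊢
  have e1 : 1 / (1 + (Real.tanh x / Real.sqrt 3) ^ 2) * ((Real.cosh x ^ 2)⁻¹ / Real.sqrt 3) =
      Real.sqrt 3 / (3 * Real.cosh x ^ 2 + Real.sinh x ^ 2) := by
    rw [Real.tanh_eq_sinh_div_cosh]
    have hr' : Real.sqrt 3 ≠ 0 := hr0.ne'
    field_simp
    linear_combination (-(Real.cosh x) ^ 2) * hr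
  rw [e1, hs, div_eq_div_iff ?_ hd]
  · ring
  · nlinarith [Real.one_le_cosh x]

/-- The scattering kernel `G'` is even. [folklore] -/
theorem bu_kernel_even (x : ℝ) :
    Real.sqrt 3 / 2 / (Real.cosh (2 * -x) + 1 / 2) = Real.sqrt 3 / 2 / (Real.cosh (2 * x) + 1 / 2) := by
  rw [mul_neg, Real.cosh_neg]

/-! ### Abstract injectivity from kernel positivity -/

section Abstract

variable {F G F' G' : ℝ → ℝ}

/-- **Reflection trick.** For an even positive-semidefinite kernel `G'`, the "image-charge" form
`Q(u, d) = Σ_{j,l} [G'(u_j − u_l) − G'(u_j + u_l)] d_j d_l` is nonnegative: `2Q` is the kernel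
quadratic form at the `2M` points `(u, −u)` with weights `(d, −d)`. [folklore] -/
theorem bu_reflect_nonneg (hG'even : ∀ x, G' (-x) = G' x)
    (hPD : ∀ (M : ℕ) (p y : Fin M → ℝ), 0 ≤ ∑ j, ∑ l, G' (p j - p l) * y j * y l)
    {M : ℕ} (u d : Fin M → ℝ) :
    0 ≤ ∑ j, ∑ l, (G' (u j - u l) - G' (u j + u l)) * d j * d l := by
  have key : ∀ j l : Fin M,
      G' (u j - u l) * d j * d l + G' (u j - -u l) * d j * -d l +
        (G' (-u j - u l) * -d j * d l + G' (-u j - -u l) * -d j * -d l) =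
      2 * ((G' (u j - u l) - G' (u j + u l)) * d j * d l) := by
    intro j l
    have e1 : G' (u j - -u l) = G' (u j + u l) := by rw [sub_neg_eq_add]
    have e2 : G' (-u j - u l) = G' (u j + u l) := by
      rw [show -u j - u l = -(u j + u l) by ring, hG'even]
    have e3 : G' (-u j - -u l) = G' (u j - u l) := by
      rw [show -u j - -u l = -(u j - u l) by ring, hG'even]
    rw [e1, e2, e3]; ring
  have h := hPD (M + M) (Fin.append u (fun j => -u j)) (Fin.append d (fun j => -d j))
  have e : ∑ J, ∑ L, G' (Fin.append u (fun j => -u j) J - Fin.append u (fun j => -u j) L) *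
      Fin.append d (fun j => -d j) J * Fin.append d (fun j => -d j) L =
      2 * ∑ j, ∑ l, (G' (u j - u l) - G' (u j + u l)) * d j * d l := by
    simp only [Fin.sum_univ_add, Fin.append_left, Fin.append_right]
    rw [Finset.mul_sum, ← Finset.sum_add_distrib]
    refine Finset.sum_congr rfl fun j _ => ?_
    rw [Finset.mul_sum, ← Finset.sum_add_distrib, ← Finset.sum_add_distrib, ← Finset.sum_add_distrib]
    exact Finset.sum_congr rfl fun l _ => key j l
  rw [e] at h
  linarith

/-- **Completing the square on the diagonal.** The quadratic form of the Jacobian of the Bethe map,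
`Σ_j d_j [N F'(u_j) d_j − Σ_{l ≠ j}(G'(u_j − u_l)(d_j − d_l) + G'(u_j + u_l)(d_j + d_l))]`, equals
`Σ_j c_j(u) d_j² + Q(u, d)` with `c_j(u) = N F'(u_j) − Σ_{l ≠ j}[G'(u_j − u_l) + G'(u_j + u_l)] − G'(0)
+ G'(2u_j)` and `Q` the image-charge form over all pairs. [folklore] -/
theorem bu_quadForm_decomp {M : ℕ} (N : ℝ) (u d : Fin M → ℝ) :
    ∑ j, d j * (N * (F' (u j) * d j) -
        ∑ l ∈ Finset.univ.erase j, (G' (u j - u l) * (d j - d l) + G' (u j + u l) * (d j + d l))) =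
      ∑ j, (N * F' (u j) - ∑ l ∈ Finset.univ.erase j, (G' (u j - u l) + G' (u j + u l)) - G' 0 +
          G' (2 * u j)) * d j ^ 2 +
        ∑ j, ∑ l, (G' (u j - u l) - G' (u j + u l)) * d j * d l := by
  rw [← Finset.sum_add_distrib]
  refine Finset.sum_congr rfl fun j _ => ?_
  rw [← Finset.add_sum_erase _ _ (Finset.mem_univ j), sub_self, ← two_mul]
  have h1 : ∑ l ∈ Finset.univ.erase j, (G' (u j - u l) * (d j - d l) + G' (u j + u l) * (d j + d l)) =
      d j * ∑ l ∈ Finset.univ.erase j, (G' (u j - u l) + G' (u j + u l)) -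
        ∑ l ∈ Finset.univ.erase j, (G' (u j - u l) - G' (u j + u l)) * d l := by
    rw [Finset.mul_sum, ← Finset.sum_sub_distrib]
    exact Finset.sum_congr rfl fun l _ => by ring
  have h2 : ∑ l ∈ Finset.univ.erase j, (G' (u j - u l) - G' (u j + u l)) * d j * d l =
      d j * ∑ l ∈ Finset.univ.erase j, (G' (u j - u l) - G' (u j + u l)) * d l := by
    rw [Finset.mul_sum]
    exact Finset.sum_congr rfl fun l _ => by ring
  rw [h1, h2]
  ring

/-- **Derivative of the pairing along a line.** For primitives `F`, `G` of `F'`, `G'`, the pairing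
`t ↦ Σ_j d_j Φ(w + t d)_j` of the Bethe map with the direction `d` is differentiable at every `t`,
with derivative the Jacobian quadratic form at `w + t d`. [folklore] -/
theorem bu_hasDerivAt_pairing (hF : ∀ x, HasDerivAt F (F' x) x) (hG : ∀ x, HasDerivAt G (G' x) x)
    {M : ℕ} (N : ℝ) (w d : Fin M → ℝ) (t : ℝ) :
    HasDerivAt (fun t : ℝ => ∑ j, d j * (N * F (w j + t * d j) -
        ∑ l ∈ Finset.univ.erase j,
          (G (w j + t * d j - (w l + t * d l)) + G (w j + t * d j + (w l + t * d l)))))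
      (∑ j, d j * (N * (F' (w j + t * d j) * d j) -
        ∑ l ∈ Finset.univ.erase j, (G' (w j + t * d j - (w l + t * d l)) * (d j - d l) +
          G' (w j + t * d j + (w l + t * d l)) * (d j + d l)))) t := by
  have hlin : ∀ j : Fin M, HasDerivAt (fun t : ℝ => w j + t * d j) (d j) t := fun j =>
    (hasDerivAt_mul_const (d j)).const_add (w j)
  refine HasDerivAt.fun_sum fun j _ =>
    HasDerivAt.const_mul (d j) (HasDerivAt.fun_sub ?_ (HasDerivAt.fun_sum fun l _ => ?_))
  · have h1 := (hF (w j + t * d j)).comp t (hlin j)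
    simp only [Function.comp_def] at h1
    exact h1.const_mul N
  · have h1 := (hG (w j + t * d j - (w l + t * d l))).comp t ((hlin j).fun_sub (hlin l))
    have h2 := (hG (w j + t * d j + (w l + t * d l))).comp t ((hlin j).fun_add (hlin l))
    simp only [Function.comp_def] at h1 h2
    exact h1.fun_add h2

/-- **Abstract injectivity of the Bethe map.** If `F' = dF`, `G' = dG`, `G'` is even and positive
semidefinite, then `w ↦ (N F(w_j) − Σ_{l ≠ j}[G(w_j − w_l) + G(w_j + w_l)])_j` is injective on every
convex set on which all diagonal Yang–Yang coefficients
`N F'(w_j) − Σ_{l ≠ j}[G'(w_j − w_l) + G'(w_j + w_l)] − G'(0) + G'(2w_j)` are positive (Rolle on the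
pairing with `d = w' − w`, whose derivative dominates `Σ_j c_j d_j²`). [folklore] -/
theorem bu_injOn_of_kernel_posSemidef (F G F' G' : ℝ → ℝ)
    (hF : ∀ x, HasDerivAt F (F' x) x) (hG : ∀ x, HasDerivAt G (G' x) x)
    (hG'even : ∀ x, G' (-x) = G' x)
    (hPD : ∀ (M : ℕ) (p y : Fin M → ℝ), 0 ≤ ∑ j, ∑ l, G' (p j - p l) * y j * y l)
    (N : ℝ) {M : ℕ} {D : Set (Fin M → ℝ)} (hD : Convex ℝ D)
    (hc : ∀ w ∈ D, ∀ j : Fin M, 0 < N * F' (w j) -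
      ∑ l ∈ Finset.univ.erase j, (G' (w j - w l) + G' (w j + w l)) - G' 0 + G' (2 * w j)) :
    Set.InjOn (fun w : Fin M → ℝ ↦ fun j : Fin M ↦
      N * F (w j) - ∑ l ∈ Finset.univ.erase j, (G (w j - w l) + G (w j + w l))) D := by
  intro w hw w' hw' heq
  -- the direction `d = w' - w`, the pairing `ψ(t) = Σ_j d_j Φ(w + t d)_j` and its derivative `ψ'`
  obtain ⟨d, hd⟩ : ∃ d : Fin M → ℝ, ∀ j, d j = w' j - w j := ⟨fun j => w' j - w j, fun j => rfl⟩
  obtain ⟨ψ, hψ⟩ : ∃ ψ : ℝ → ℝ, ∀ t, ψ t = ∑ j, d j * (N * F (w j + t * d j) -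
      ∑ l ∈ Finset.univ.erase j,
        (G (w j + t * d j - (w l + t * d l)) + G (w j + t * d j + (w l + t * d l)))) :=
    ⟨_, fun t => rfl⟩
  obtain ⟨ψ', hψ'⟩ : ∃ ψ' : ℝ → ℝ, ∀ t, ψ' t = ∑ j, d j * (N * (F' (w j + t * d j) * d j) -
      ∑ l ∈ Finset.univ.erase j, (G' (w j + t * d j - (w l + t * d l)) * (d j - d l) +
        G' (w j + t * d j + (w l + t * d l)) * (d j + d l))) :=
    ⟨_, fun t => rfl⟩
  have hder : ∀ t, HasDerivAt ψ (ψ' t) t := by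
    intro t
    rw [show ψ = _ from funext hψ, hψ']
    exact bu_hasDerivAt_pairing hF hG N w d t
  -- `ψ 0 = ψ 1` because `Φ w = Φ w'`
  have h01 : ψ 0 = ψ 1 := by
    rw [hψ, hψ]
    refine Finset.sum_congr rfl fun j _ => ?_
    have hj := congrFun heq j
    simp only at hj
    have e : ∀ i, w i + 1 * d i = w' i := fun i => by rw [hd]; ring
    simp only [zero_mul, add_zero, e, hj]
  -- Rolle: `ψ' ξ = 0` for some `ξ ∈ (0, 1)`; the point `u = w + ξ d` lies in `D`
  obtain ⟨ξ, hξ, hξ0⟩ := exists_hasDerivAt_eq_zero zero_lt_one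
    (fun t _ => (hder t).continuousAt.continuousWithinAt) h01 fun t _ => hder t
  obtain ⟨u, hu⟩ : ∃ u : Fin M → ℝ, ∀ j, u j = w j + ξ * d j :=
    ⟨fun j => w j + ξ * d j, fun j => rfl⟩
  have hmem : u ∈ D := by
    have e : u = w + ξ • (w' - w) := by
      funext j
      simp only [hu, hd, Pi.add_apply, Pi.smul_apply, Pi.sub_apply, smul_eq_mul]
    rw [e]
    exact hD.add_smul_sub_mem hw hw' ⟨hξ.1.le, hξ.2.le⟩
  -- `0 = ψ' ξ = Σ_j c_j(u) d_j² + Q(u, d)` with `Q ≥ 0` and every `c_j(u) > 0`: so `d = 0`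
  have hdec : ψ' ξ = ∑ j, (N * F' (u j) - ∑ l ∈ Finset.univ.erase j, (G' (u j - u l) + G' (u j + u l)) -
      G' 0 + G' (2 * u j)) * d j ^ 2 + ∑ j, ∑ l, (G' (u j - u l) - G' (u j + u l)) * d j * d l := by
    rw [hψ', ← bu_quadForm_decomp N u d]
    simp only [hu]
  have hQ := bu_reflect_nonneg hG'even hPD u d
  have hnn : ∀ j ∈ (Finset.univ : Finset (Fin M)), 0 ≤ (N * F' (u j) -
      ∑ l ∈ Finset.univ.erase j, (G' (u j - u l) + G' (u j + u l)) - G' 0 + G' (2 * u j)) * d j ^ 2 :=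
    fun j _ => mul_nonneg (hc u hmem j).le (sq_nonneg _)
  have h0 : ∑ j, (N * F' (u j) - ∑ l ∈ Finset.univ.erase j, (G' (u j - u l) + G' (u j + u l)) -
      G' 0 + G' (2 * u j)) * d j ^ 2 = 0 :=
    le_antisymm (by linarith [Finset.sum_nonneg hnn]) (Finset.sum_nonneg hnn)
  have hall := (Finset.sum_eq_zero_iff_of_nonneg hnn).1 h0
  funext j
  rcases mul_eq_zero.1 (hall j (Finset.mem_univ j)) with h | h
  · exact absurd h (hc u hmem j).ne'
  · have : d j = 0 := (pow_eq_zero_iff two_ne_zero).1 h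
    rw [hd] at this
    linarith

end Abstract

/-! ### The registered helper -/

/-- **U · injectivity of the Bethe map on good convex sets** (registered helper of
`stmt-CriticalPhenomena-13878`, line `two-cluster-rate-is-stationary-gap`). Given positive
semidefiniteness of the scattering kernel `G'(x) = (√3/2)/(cosh 2x + 1/2)`, the Bethe map
`w ↦ (N·F(w_j) − Σ_{l ≠ j}[G(w_j − w_l) + G(w_j + w_l)])_j`,
`F(w) = arctan((2+√3) tanh w) + arctan(tanh w)`, `G(x) = arctan(tanh x/√3)`, is injective on every
convex `D ⊆ ℝ^M` on which the diagonal Yang–Yang coefficients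
`N F'(w_j) − Σ_{l ≠ j}[G'(w_j − w_l) + G'(w_j + w_l)] − G'(0) + G'(2w_j)` are positive — so the
Bethe equations with given quantum numbers have at most one solution in `D`. Instance of
`bu_injOn_of_kernel_posSemidef` with the closed-form derivatives `bu_hasDerivAt_F`,
`bu_hasDerivAt_G`. [folklore] -/
theorem bu_betheMap_injOn : (∀ (M : ℕ) (p y : Fin M → ℝ), 0 ≤ ∑ j, ∑ l, Real.sqrt 3 / 2 / (Real.cosh (2 * (p j - p l)) + 1 / 2) * y j * y l) → ∀ (N M : ℕ) (D : Set (Fin M → ℝ)), Convex ℝ D → (∀ w ∈ D, ∀ j : Fin M, 0 < (N : ℝ) * (1 / 2 / (Real.cosh (2 * w j) - Real.sqrt 3 / 2) + 1 / Real.cosh (2 * w j)) - ∑ l ∈ Finset.univ.erase j, (Real.sqrt 3 / 2 / (Real.cosh (2 * (w j - w l)) + 1 / 2) + Real.sqrt 3 / 2 / (Real.cosh (2 * (w j + w l)) + 1 / 2)) - Real.sqrt 3 / 2 / (Real.cosh (2 * 0) + 1 / 2) + Real.sqrt 3 / 2 / (Real.cosh (2 * (2 * w j)) + 1 / 2)) →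 Set.InjOn (fun w : Fin M → ℝ ↦ fun j : Fin M ↦ (N : ℝ) * (Real.arctan ((2 + Real.sqrt 3) * Real.tanh (w j)) + Real.arctan (Real.tanh (w j))) - ∑ l ∈ Finset.univ.erase j, (Real.arctan (Real.tanh (w j - w l) / Real.sqrt 3) + Real.arctan (Real.tanh (w j + w l) / Real.sqrt 3))) D := by
  intro hPD N M D hD hc
  exact bu_injOn_of_kernel_posSemidef
    (fun w => Real.arctan ((2 + Real.sqrt 3) * Real.tanh w) + Real.arctan (Real.tanh w))
    (fun x => Real.arctan (Real.tanh x / Real.sqrt 3))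
    (fun w => 1 / 2 / (Real.cosh (2 * w) - Real.sqrt 3 / 2) + 1 / Real.cosh (2 * w))
    (fun x => Real.sqrt 3 / 2 / (Real.cosh (2 * x) + 1 / 2))
    bu_hasDerivAt_F bu_hasDerivAt_G bu_kernel_even hPD N hD hc

end Summit.CriticalPhenomena.CardyFormulaZ2.Cruxes.StripClusterRates.TwoClusterRateIsStationaryGap

end
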